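import Summits.QuantumFields.YangMills.Theorems.UnitScaleTiltProp8HalvingDressingLetterFlat
import Summits.QuantumFields.YangMills.Theorems.UnitScaleTiltProp8FlatHScaledExtension
import HarnessLib

/-!
# Route `UnitScaleTilt`, crux K1 child «MinimiserStabilityRegPr» (stmt-QuantumFields-19200), registered stub V2′ `stub_halvingStep`
# (skeleton v10 `BirthV10`) — **THE DRESSING LETTER `C_E` AT THE `H` OF RECORD `Hs` (THE LEVEL-SCALED `flatH` EXTENSION; ♭ KNIT, FILE D♯)** —
# ✓ p608349 FILE C `HalvingDressingLetter.exists_hWq_dressed_cubeSeq_T3_of_columnLetters` READ AT `Hs X (b) = Σ_c ((flatH e_c)(b)·(L^{j(c)}η)⁻¹) • X(c)` (print's `H`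
# of (45) «`LʲηQ_jHB = B`», ★★OWNER RULING g26-№11 (i)), with (46) `hH`, (X2-H) `hHcol`, (X2-CH) `hCH` DISCHARGED BY NAME at the record's index weight
# `u(c) = η⁻³(L^{j(c)}η)⁻¹`, and (X1) `hX1` reduced to the displayed LEVEL-WEIGHTED-DATA `∂^{η*}∂^η`-row (X1♯) of `flatH` (★w3-19200 g4 LOCATED 07:21:35Z; WANTED №g26-1
# re-opened under ♭; supplier ★w3-19936 g4)

Cell `ym3-torus` (HUMAN RULING D-0037, YM ladder rung R3 — continuum SU(2) YM₃ on the torus is a RUNG, not the Clay problem), width seat `ym-ust-19200-w6`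
(D-0154 (3c); ★★OWNER ym3-torus-plan g26 RULING g26-№6 (S5)∕(S7), №7 (2), №11 (i)).  `--supports stmt-QuantumFields-19200 --as helper`; count-neutral; def-free,
0 sorry, standard axioms.

WHY.  The chart's linearisation is `η·Lʲ·Q_j` (CERT-2 ✓ `fderiv_chartLogFlat_zero_apply`), and `Q_j(flatH X) = X` (✓ `FlatCubeOperators`), so the right inverse the chart
construction (49) needs is the level-SCALED extension `Hs = HM ∘ diag((L^{j}η)⁻¹)` (✓ p612533 `FlatHDressingShape.exists_flatH_scaledExt`), not the unscaled `HM` of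
✓ p613509 (FILE D).  `Hs` is the kernel extension of the scaled SCALAR operator `Hσ := flatH ∘ₗ diag(λ⁻¹)`, `λ_c = L^{j(c)}η`, so FILE D's machinery applies to `Hσ`
verbatim; the scalar input rows are then read at data `λ_c|Y c| ≤ t`: (46) is P2's `HSupLetterG` met with EQUALITY (✓ `supRow_scaledKernel`∕`gradRow_scaledKernel`, guard
discharged by lit-balaban's ✓ `B9Thm39ReadingCoords.bondIdx_nonempty`); the (X2-CH) pairing letter and the (X2-H) column sum ABSORB the scaling into the index weight
(`η⁻³ ↦ η⁻³λ_c⁻¹` = the record's `u`, no new supplier); the (X1) sup row does NOT absorb it — it needs the `λ`-sharp row (X1♯), displayed here as a hypothesis.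

WHAT THIS FILE PROVES (sorry-free; no definition; `M₂ = Matrix (Fin 2) (Fin 2) ℂ`, L²-operator norm; `η = L^{−(K−n)}`, `λ_c = L^{j(c)}·(L⁻¹)^{K−n}`):
* §1 ★ `exists_scaledOp` — the scaled scalar operator `Hσ : (BondIdx D → ℝ) →ₗ[ℝ] (PBond → ℝ)` with `Hσ Y = flatH (λ⁻¹·Y)` and kernel `Hσ e_c (b) = (flatH e_c)(b)·λ_c⁻¹`
  (built in-proof from `LinearMap` literals; no `def`).
* §2 ★★ **`hLetters_flatHs_of_adm22`** — for odd `L = ℓ + 1 ≥ 5` there are `M_h⁰, R₀` and `B_H, K₀, C_P ≥ 0` (from `L` alone) such that at every admissible datum of the P2 text,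
  for EVERY presentation `HS` with the display of record `hHS : ∀ X b, HS X b = Σ_c ((flatH e_c)(b)·λ_c⁻¹) • X c` (= `exists_flatH_scaledExt` (i) verbatim) and every index
  weight `u ≥ η⁻³λ⁻¹`: FILE C's `hH` (both (46) rows, unguarded, NO `Nonempty` premiss) with `B_H`; FILE C's `hHcol` with `h₁ := K₀`; FILE C's `hCH` with `B_CH := 2C_P`; and
  `∀ B_Δ ≥ 0, (X1♯ with B_Δ) → FILE C's hX1 with B_Δ`.
* §3 ★★ **`exists_hWq_dressed_cubeSeq_T3_flatHs`** — THE ♭ KNIT OF RECORD AT `H := Hs`: FILE C's `exists_hWq_dressed_cubeSeq_T3_of_columnLetters` at the aligned cube sequence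
  (144) `cubeSeqMT3 F n K x₀ ρ S (L·M_h)` (`R·(L·M_h) ≤ S`), P3b's `W₀` BY NAME, `H` ANY ℂ-linear map with the display `hHS`, with `hH`∕`hHcol`∕`hCH` DISCHARGED; displayed residue =
  (X1♯) (`B_Δ`) + the chart side (`hD` (55), `h49`∕`hDd`∕`hCd`, `hCcol` (X2-C′) at `u ≥ η⁻³λ⁻¹`, numerics `C₃·R_c·K₀ ≤ ½`, `a₃ ≤ R_c⁰ < R_c`, `(1 + 4B_HC₂R_c⁰)a₃ ≤ 1/(2L)`);
  constant `C₄ = C₀θ² + 2B_ΔC₂ + ½(8C₃(2C_P))θ + 16K₀C₃R_c⁰C₀θ²`, `C₀ = 12L³(1428 + L)`, `θ = 1 + 4B_HC₂R_c⁰` — the `hWq` binder of ✓ `row165_of_tracePairing_L5_anyW`.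
HONEST SCOPE.  Bookkeeping over landed certificates; (X1♯) and the chart side ((S3) B2∕B3 ✓, (S4) ✓p612993, (S6)) are NOT proved here.  NOT a claim about the stub, the crux,
the rung or the mass gap; no summit statement is proved by this seat.

References: T. Bałaban, CMP **102** (1985) 277–309 [Balaban1985Variational] (44)–(46) p.285, (49) p.285, (55) p.286, (73) p.289, (80)–(89) pp.290–291, (88) p.291, Prop. 4
(97)–(98) pp.292–293, (144) p.300, (157)–(158) p.302, (161)–(163) p.303; CMP **96** (1984) 223–250 [Balaban1984PropagatorsII] (2.1)–(2.4) p.224, Lemma 2.1 (2.61) p.234,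
Cor. 2.8 (2.150)–(2.151) p.249.
-/

set_option autoImplicit false

noncomputable section

open scoped BigOperators Matrix Matrix.Norms.L2Operator
open NormedSpace Filter Topology

namespace Summit.QuantumFields.YangMills.Theorems.HalvingDressingLetter

open Literature.MathematicalPhysics.QuantumFieldTheory.Balaban1983to89
open B6GlobalChartV1 (PV)
open B6SectADomainsV1 (Domains)
open B6SectAOperatorsV1 (BondIdx dcE dcsE)
open T3ContinuumYM3Torus (T3Family)
open FlatCubeOpsText (Adm22 IsLevWeight HSupLetterG)
open FlatOpsLettersAssembly (flatH levWeight_nonneg)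
open FlatCubeSequenceAligned (cubeSeqMT3 cubeSeqMT3_k)
open FlatCubeSequenceAdm (adm22_cubeSeqMT3)
open FlatPortBodyL0 (rowsAt_of_adm22)
open FlatPortCurlCurlPairingL0 (curlCurlPairing_of_adm22)
open FlatPortColumnLetterL0 (columnInputs_of_adm22)
open FlatHCurlCurlMatrix (matrix_curlCurlSupRow matrix_curlCurlPairing)
open FlatHDressingShape (supRow_scaledKernel gradRow_scaledKernel)
open B9Thm39ReadingCoords (bondIdx_nonempty)

/-! ## §1 The scaled scalar operator `Hσ = flatH ∘ diag(λ⁻¹)` -/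

/-- ★ **THE LEVEL-SCALED SCALAR OPERATOR** `Hσ := flatH ∘ₗ diag((L^{j(c)}η)⁻¹)`: an ℝ-linear map with `Hσ Y = flatH (c ↦ λ_c⁻¹·Y c)` and kernel `Hσ e_c (b) = (flatH e_c)(b)·λ_c⁻¹`
— so that `Hs`, the `H` of record of the ♭ chart (RULING g26-№11 (i); ✓ `exists_flatH_scaledExt`), is the kernel extension of `Hσ` and FILE D's (X1)ᴹ∕(X2-H)ᴹ∕(X2-CH)ᴹ readings
apply to it. [cite: Balaban1985Variational, (45)-(46) p.285, (157) p.302] -/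
theorem exists_scaledOp (F : T3Family) (n K : ℕ) (D : Domains (F.P K)) (lam : BondIdx D → ℝ) :
    ∃ Hσ : (BondIdx D → ℝ) →ₗ[ℝ] (PBond (F.P K) 0 → ℝ),
      (∀ Y : BondIdx D → ℝ, Hσ Y = flatH F n K D (fun c => (lam c)⁻¹ * Y c)) ∧
      ∀ (c : BondIdx D) (b : PBond (F.P K) 0), Hσ (Pi.single c 1) b = flatH F n K D (Pi.single c 1) b * (lam c)⁻¹ := by
  let S : (BondIdx D → ℝ) →ₗ[ℝ] (BondIdx D → ℝ) :=
    { toFun := fun Y c => (lam c)⁻¹ * Y c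
      map_add' := fun Y Y' => funext fun c => by simp only [Pi.add_apply]; ring
      map_smul' := fun a Y => funext fun c => by simp only [Pi.smul_apply, smul_eq_mul, RingHom.id_apply]; ring }
  have hS : ∀ (Y : BondIdx D → ℝ) (c : BondIdx D), S Y c = (lam c)⁻¹ * Y c := fun _ _ => rfl
  have hSe : ∀ c : BondIdx D, S (Pi.single c 1) = (lam c)⁻¹ • (Pi.single c (1 : ℝ) : BondIdx D → ℝ) := fun c => by
    funext c'
    rw [hS, Pi.smul_apply, smul_eq_mul]
    by_cases h : c' = c
    · subst h; rfl
    · rw [Pi.single_eq_of_ne h, mul_zero, mul_zero]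
  refine ⟨flatH F n K D ∘ₗ S, fun Y => ?_, fun c b => ?_⟩
  · rw [LinearMap.comp_apply]
    exact congrArg (flatH F n K D) (funext fun c => hS Y c)
  · rw [LinearMap.comp_apply, hSe, map_smul, Pi.smul_apply, smul_eq_mul]
    exact mul_comm _ _

/-! ## §2 The H-side letters of FILE C at `H := Hs`, every admissible family of the P2 text -/

/-- `1 ≤ 3` (named once; every `PV` below carries the same proof term). [folklore] -/
private theorem hd3 : 1 ≤ 2 + 1 := by norm_num

/-- ★★ **THE H-SIDE LETTERS OF THE DRESSING KNIT AT THE `H` OF RECORD `Hs`, EVERY ADMISSIBLE FAMILY, CONSTANTS FROM `L` ALONE**: for odd `L = ℓ + 1 ≥ 5` there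
are `M_h⁰, R₀` and `B_H, K₀, C_P ≥ 0` such that at every admissible datum of the P2 text (binders of ✓ `FlatPortBodyL0.rowsAt_of_adm22`), for EVERY presentation `HS` with
`HS X b = Σ_c ((flatH e_c)(b)·λ_c⁻¹) • X c` (`λ_c = L^{j(c)}(L⁻¹)^{K−n}`) and every index weight `u ≥ (L^{K−n})³·λ⁻¹`: (46)ᴹ both rows UNGUARDED (✓ `supRow_scaledKernel`∕
`gradRow_scaledKernel` at P2's first row-list entry, guard by ✓ `bondIdx_nonempty`) — FILE C's `hH`; `∀ B_Δ ≥ 0`, the level-weighted `∂^{η*}∂^η`-row (X1♯) ⟹ FILE C's `hX1`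
(✓ `matrix_curlCurlSupRow` at `Hσ`); (X2-H)ᴹ — FILE C's `hHcol` with `h₁ := K₀` (FILE D §1 ∘ ✓ `columnInputs_of_adm22`, the factor `λ⁻¹` riding on the weight); (X2-CH)ᴹ —
FILE C's `hCH` with `B_CH := 2C_P` (✓ `matrix_curlCurlPairing` at `Hσ` ∘ ✓ `curlCurlPairing_of_adm22`, idem).
[cite: Balaban1985Variational, (44)-(46) p.285, (88) p.291, (157) p.302, (161)-(163) p.303; Balaban1984PropagatorsII, (2.1)-(2.4) p.224, Lemma 2.1 (2.61) p.234, Cor. 2.8 (2.150)-(2.151) p.249] -/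
theorem hLetters_flatHs_of_adm22 (ℓ : ℕ) (hL : Odd (ℓ + 1) ∧ 1 < ℓ + 1) (hℓ : 4 ≤ ℓ) :
    ∃ (Mh₀ R₀ : ℕ) (BH K₀ CP : ℝ), 0 ≤ BH ∧ 0 ≤ K₀ ∧ 0 ≤ CP ∧
    ∀ (m : ℕ) (hm : 1 ≤ m) (n K : ℕ) (_ : 1 ≤ K - n) (_ : K - n + 1 ≤ m + K) {Mh R a' : ℕ} (_ : Mh = (ℓ + 1) ^ a') (_ : Mh₀ ≤ Mh) (_ : R₀ ≤ R)
      (_ : a' + 3 ≤ m + n) (D : Domains (PV 2 ℓ m K hd3 hL)) (_ : D.k = K - n) (_ : Adm22 D R ((ℓ + 1) * Mh))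
      (w : ℕ → PBond (PV 2 ℓ m K hd3 hL) 0 → ℝ) (_ : IsLevWeight (⟨ℓ + 1, hL, m, hm⟩ : T3Family) n K D w)
      (HS : (BondIdx D → Matrix (Fin 2) (Fin 2) ℂ) → PBond (PV 2 ℓ m K hd3 hL) 0 → Matrix (Fin 2) (Fin 2) ℂ)
      (_ : ∀ (X : BondIdx D → Matrix (Fin 2) (Fin 2) ℂ) (b : PBond (PV 2 ℓ m K hd3 hL) 0),
        HS X b = ∑ c : BondIdx D, (flatH (⟨ℓ + 1, hL, m, hm⟩ : T3Family) n K D (Pi.single c 1) b *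
          ((((ℓ + 1 : ℕ) : ℝ)) ^ (c.1.1 : ℕ) * ((((ℓ + 1 : ℕ) : ℝ))⁻¹) ^ (K - n))⁻¹) • X c)
      (u : BondIdx D → ℝ)
      (_ : ∀ c, ((((ℓ + 1 : ℕ) : ℝ)) ^ (K - n)) ^ 3 * ((((ℓ + 1 : ℕ) : ℝ)) ^ (c.1.1 : ℕ) * ((((ℓ + 1 : ℕ) : ℝ))⁻¹) ^ (K - n))⁻¹ ≤ u c),
      (∀ (X : BondIdx D → Matrix (Fin 2) (Fin 2) ℂ) (t : ℝ), (∀ c, ‖X c‖ ≤ t) →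
        (∀ b, w 1 b * ‖HS X b‖ ≤ BH * t) ∧
        ∀ (b : PBond (PV 2 ℓ m K hd3 hL) 0) (ν : Fin 3),
          w 2 b * ((ℓ + 1 : ℕ) : ℝ) ^ (K - n) * ‖HS X ⟨b.src.shift ν, b.dir⟩ - HS X b‖ ≤ BH * t) ∧
      (∀ {BΔ : ℝ}, 0 ≤ BΔ →
        (∀ (Y : BondIdx D → ℝ) (t : ℝ), 0 ≤ t →
          (∀ c, (((ℓ + 1 : ℕ) : ℝ)) ^ (c.1.1 : ℕ) * ((((ℓ + 1 : ℕ) : ℝ))⁻¹) ^ (K - n) * |Y c| ≤ t) →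
          ∀ b : PBond (PV 2 ℓ m K hd3 hL) 0,
            w 3 b * |(dcsE ((((ℓ + 1 : ℕ) : ℝ)) ^ (K - n)) (dcE ((((ℓ + 1 : ℕ) : ℝ)) ^ (K - n))
              (WithLp.toLp 2 (flatH (⟨ℓ + 1, hL, m, hm⟩ : T3Family) n K D Y)))) b| ≤ BΔ * t) →
        ∀ (X : BondIdx D → Matrix (Fin 2) (Fin 2) ℂ) (t : ℝ), 0 ≤ t → (∀ c, ‖X c‖ ≤ t) → ∀ b : PBond (PV 2 ℓ m K hd3 hL) 0,
          w 3 b * ‖((((((((ℓ + 1 : ℕ) : ℝ)⁻¹) ^ (K - n)) : ℝ) : ℂ) ^ 2)⁻¹ • ∑ p : Plaq (PV 2 ℓ m K hd3 hL) 0,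
            ((Pi.single b (1 : ℂ) : PBond (PV 2 ℓ m K hd3 hL) 0 → ℂ) ⟨p.src, p.μ⟩ + (Pi.single b (1 : ℂ) : PBond (PV 2 ℓ m K hd3 hL) 0 → ℂ) ⟨p.src.shift p.μ, p.ν⟩ -
                (Pi.single b (1 : ℂ) : PBond (PV 2 ℓ m K hd3 hL) 0 → ℂ) ⟨p.src.shift p.ν, p.μ⟩ - (Pi.single b (1 : ℂ) : PBond (PV 2 ℓ m K hd3 hL) 0 → ℂ) ⟨p.src, p.ν⟩) •
              (HS X ⟨p.src, p.μ⟩ + HS X ⟨p.src.shift p.μ, p.ν⟩ - HS X ⟨p.src.shift p.ν, p.μ⟩ - HS X ⟨p.src, p.ν⟩))‖ ≤ BΔ * t) ∧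
      (∀ X : BondIdx D → Matrix (Fin 2) (Fin 2) ℂ, ∑ b, (w 3 b)⁻¹ * ‖HS X b‖ ≤ K₀ * ∑ c, u c * ‖X c‖) ∧
      (∀ (Z : PBond (PV 2 ℓ m K hd3 hL) 0 → Matrix (Fin 2) (Fin 2) ℂ) (s : ℝ), 0 ≤ s → (∀ b, w 1 b * ‖Z b‖ ≤ s) →
        (∀ (b : PBond (PV 2 ℓ m K hd3 hL) 0) (ν : Fin 3), w 2 b * ((ℓ + 1 : ℕ) : ℝ) ^ (K - n) * ‖Z ⟨b.src.shift ν, b.dir⟩ - Z b‖ ≤ s) →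
        ∀ X : BondIdx D → Matrix (Fin 2) (Fin 2) ℂ,
          ‖∑ b, Matrix.trace (((((((((ℓ + 1 : ℕ) : ℝ)⁻¹) ^ (K - n)) : ℝ) : ℂ) ^ 2)⁻¹ • ∑ p : Plaq (PV 2 ℓ m K hd3 hL) 0,
            ((Pi.single b (1 : ℂ) : PBond (PV 2 ℓ m K hd3 hL) 0 → ℂ) ⟨p.src, p.μ⟩ + (Pi.single b (1 : ℂ) : PBond (PV 2 ℓ m K hd3 hL) 0 → ℂ) ⟨p.src.shift p.μ, p.ν⟩ -
                (Pi.single b (1 : ℂ) : PBond (PV 2 ℓ m K hd3 hL) 0 → ℂ) ⟨p.src.shift p.ν, p.μ⟩ - (Pi.single b (1 : ℂ) : PBond (PV 2 ℓ m K hd3 hL) 0 → ℂ) ⟨p.src, p.ν⟩) •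
              (HS X ⟨p.src, p.μ⟩ + HS X ⟨p.src.shift p.μ, p.ν⟩ - HS X ⟨p.src.shift p.ν, p.μ⟩ - HS X ⟨p.src, p.ν⟩)) * Z b)‖ ≤
            2 * CP * s * ∑ c, u c * ‖X c‖) := by
  obtain ⟨Mh₁, R₁, C, δ₀, B₃, CG, hC, -, -, -, hrows⟩ := rowsAt_of_adm22 ℓ hL hℓ
  obtain ⟨Mh₃, R₃, K₀, hK₀, hcols⟩ := columnInputs_of_adm22 ℓ hL hℓ
  obtain ⟨Mh₄, R₄, CP, hCP, hpair⟩ := curlCurlPairing_of_adm22 ℓ hL hℓ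
  refine ⟨max Mh₁ (max Mh₃ Mh₄), max R₁ (max R₃ R₄), max C (C * B₃), K₀, CP, le_max_of_le_left hC, hK₀, hCP, ?_⟩
  intro m hm n K hk1 hk' Mh R a' hMha hMh hR hsize D hDk hAdm w hw HS hHS u hu
  -- thresholds of the three suppliers
  have hMh₁ : Mh₁ ≤ Mh := le_trans (le_max_left _ _) hMh
  have hMh₃ : Mh₃ ≤ Mh := le_trans (le_trans (le_max_left _ _) (le_max_right _ _)) hMh
  have hMh₄ : Mh₄ ≤ Mh := le_trans (le_trans (le_max_right _ _) (le_max_right _ _)) hMh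
  have hR₁ : R₁ ≤ R := le_trans (le_max_left _ _) hR
  have hR₃ : R₃ ≤ R := le_trans (le_trans (le_max_left _ _) (le_max_right _ _)) hR
  have hR₄ : R₄ ≤ R := le_trans (le_trans (le_max_right _ _) (le_max_right _ _)) hR
  -- the carrier's positivities and the level factors
  have hL0 : (0 : ℝ) < ((ℓ + 1 : ℕ) : ℝ) := by positivity
  have hη3 : (0 : ℝ) ≤ ((((ℓ + 1 : ℕ) : ℝ)) ^ (K - n)) ^ 3 := by positivity
  have hlam : ∀ c : BondIdx D, (0 : ℝ) < ((((ℓ + 1 : ℕ) : ℝ)) ^ (c.1.1 : ℕ) * ((((ℓ + 1 : ℕ) : ℝ))⁻¹) ^ (K - n)) := fun c => by positivity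
  have hu0 : ∀ c, 0 ≤ u c := fun c => (mul_nonneg hη3 (inv_pos.2 (hlam c)).le).trans (hu c)
  have hw1 : ∀ b, 0 ≤ w 1 b := fun b => levWeight_nonneg hw 1 b
  have hw2 : ∀ b, 0 ≤ w 2 b := fun b => levWeight_nonneg hw 2 b
  have hw3 : ∀ b, 0 < w 3 b := fun b => by
    rw [hw 3 b]
    exact pow_pos (mul_pos (pow_pos hL0 _) (pow_pos (inv_pos.2 hL0) _)) 3
  -- the scaled scalar operator and the presentation of `HS` as its kernel extension
  obtain ⟨Hσ, hσ1, hσ2⟩ := exists_scaledOp (⟨ℓ + 1, hL, m, hm⟩ : T3Family) n K D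
    (fun c => ((((ℓ + 1 : ℕ) : ℝ)) ^ (c.1.1 : ℕ) * ((((ℓ + 1 : ℕ) : ℝ))⁻¹) ^ (K - n)))
  have hHSσ : ∀ (X : BondIdx D → Matrix (Fin 2) (Fin 2) ℂ) (b : PBond (PV 2 ℓ m K hd3 hL) 0),
      HS X b = ∑ c : BondIdx D, Hσ (Pi.single c 1) b • X c := fun X b => by
    rw [hHS X b]
    exact Finset.sum_congr rfl fun c _ => congrArg (fun r : ℝ => r • X c) (hσ2 c b).symm
  -- scaled data have level-weighted size `t`
  have hscale : ∀ (Y : BondIdx D → ℝ) (t : ℝ), (∀ c, |Y c| ≤ t) → ∀ c : BondIdx D, ((((ℓ + 1 : ℕ) : ℝ)) ^ (c.1.1 : ℕ) * ((((ℓ + 1 : ℕ) : ℝ))⁻¹) ^ (K - n)) * |((((ℓ + 1 : ℕ) : ℝ)) ^ (c.1.1 : ℕ) * ((((ℓ + 1 : ℕ) : ℝ))⁻¹) ^ (K - n))⁻¹ * Y c| ≤ t := fun Y t hY c => by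
    rw [abs_mul, abs_of_pos (inv_pos.2 (hlam c)), ← mul_assoc, mul_inv_cancel₀ (hlam c).ne', one_mul]
    exact hY c
  refine ⟨fun X t hX => ?_, fun {BΔ} hBΔ hX1s => ?_, fun X => ?_, fun Z s hs _ hZ X => ?_⟩
  · -- (46)ᴹ, both rows, unguarded: P2's first row-list entry met with equality by the scaled sign data; the guard by `bondIdx_nonempty`
    obtain ⟨c₀⟩ := bondIdx_nonempty D
    have ht : 0 ≤ t := (norm_nonneg _).trans (hX c₀)
    have hsup : HSupLetterG (⟨ℓ + 1, hL, m, hm⟩ : T3Family) n K D w (flatH (⟨ℓ + 1, hL, m, hm⟩ : T3Family) n K D) (max C (C * B₃)) := by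
      obtain ⟨⟨h1, -, -⟩, -, -⟩ := hrows m hm n K hk1 hk' hMha hMh₁ hR₁ hsize D hDk hAdm w hw
      exact h1
    refine ⟨fun b => ?_, fun b ν => ?_⟩
    · rw [hHS X b]
      exact supRow_scaledKernel (⟨ℓ + 1, hL, m, hm⟩ : T3Family) n K D w hw1 (flatH (⟨ℓ + 1, hL, m, hm⟩ : T3Family) n K D) hsup X ht hX b
    · rw [hHS X ⟨b.src.shift ν, b.dir⟩, hHS X b]
      exact gradRow_scaledKernel (⟨ℓ + 1, hL, m, hm⟩ : T3Family) n K D w hw2 (flatH (⟨ℓ + 1, hL, m, hm⟩ : T3Family) n K D) hsup X ht hX b ν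
  · -- (X1)ᴹ from the level-weighted row (X1♯): the scalar row of `Hσ` at unweighted data, then FILE D's matrix reading
    have hX1σ : ∀ (Y : BondIdx D → ℝ) (t : ℝ), 0 ≤ t → (∀ c, |Y c| ≤ t) → ∀ b : PBond (PV 2 ℓ m K hd3 hL) 0,
        w 3 b * |(dcsE ((((ℓ + 1 : ℕ) : ℝ)) ^ (K - n)) (dcE ((((ℓ + 1 : ℕ) : ℝ)) ^ (K - n)) (WithLp.toLp 2 (Hσ Y)))) b| ≤ BΔ * t := by
      intro Y t ht hY b
      rw [hσ1 Y]
      exact hX1s (fun c => ((((ℓ + 1 : ℕ) : ℝ)) ^ (c.1.1 : ℕ) * ((((ℓ + 1 : ℕ) : ℝ))⁻¹) ^ (K - n))⁻¹ * Y c) t ht (hscale Y t hY) b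
    exact matrix_curlCurlSupRow (F := (⟨ℓ + 1, hL, m, hm⟩ : T3Family)) (n := n) (K := K) (D := D) (w := w) (H := Hσ) hBΔ hw3 hX1σ HS hHSσ
  · -- (X2-H)ᴹ: the kernel majorant of the port times `λ⁻¹`, column sum `K₀η⁻³λ⁻¹ ≤ K₀·u`
    obtain ⟨ks, -, hK, -, hcol⟩ := hcols m hm n K hk1 hk' hMha hMh₃ hR₃ hsize D hDk hAdm w hw
    have hw3i : ∀ b, 0 ≤ (w 3 b)⁻¹ := fun b => (inv_pos.2 (hw3 b)).le
    have hinv : (((((ℓ + 1 : ℕ) : ℝ))⁻¹) ^ (K - n))⁻¹ = (((ℓ + 1 : ℕ) : ℝ)) ^ (K - n) := by rw [inv_pow, inv_inv]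
    have hKσ : ∀ (c : BondIdx D) (b : PBond (PV 2 ℓ m K hd3 hL) 0), |Hσ (Pi.single c 1) b| ≤ ks b.src c * ((((ℓ + 1 : ℕ) : ℝ)) ^ (c.1.1 : ℕ) * ((((ℓ + 1 : ℕ) : ℝ))⁻¹) ^ (K - n))⁻¹ := fun c b => by
      rw [hσ2 c b, abs_mul, abs_of_pos (inv_pos.2 (hlam c))]
      exact mul_le_mul_of_nonneg_right (hK c b) (inv_pos.2 (hlam c)).le
    have hcolσ : ∀ c : BondIdx D, ∑ b, (w 3 b)⁻¹ * (ks b.src c * ((((ℓ + 1 : ℕ) : ℝ)) ^ (c.1.1 : ℕ) * ((((ℓ + 1 : ℕ) : ℝ))⁻¹) ^ (K - n))⁻¹) ≤ K₀ * ((((ℓ + 1 : ℕ) : ℝ)) ^ (K - n)) ^ 3 * ((((ℓ + 1 : ℕ) : ℝ)) ^ (c.1.1 : ℕ) * ((((ℓ + 1 : ℕ) : ℝ))⁻¹) ^ (K - n))⁻¹ := fun c => by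
      calc ∑ b, (w 3 b)⁻¹ * (ks b.src c * ((((ℓ + 1 : ℕ) : ℝ)) ^ (c.1.1 : ℕ) * ((((ℓ + 1 : ℕ) : ℝ))⁻¹) ^ (K - n))⁻¹) = (∑ b, (w 3 b)⁻¹ * ks b.src c) * ((((ℓ + 1 : ℕ) : ℝ)) ^ (c.1.1 : ℕ) * ((((ℓ + 1 : ℕ) : ℝ))⁻¹) ^ (K - n))⁻¹ := by
            rw [Finset.sum_mul]; exact Finset.sum_congr rfl fun b _ => by ring
        _ ≤ K₀ * (((((ℓ + 1 : ℕ) : ℝ))⁻¹) ^ (K - n))⁻¹ ^ 3 * ((((ℓ + 1 : ℕ) : ℝ)) ^ (c.1.1 : ℕ) * ((((ℓ + 1 : ℕ) : ℝ))⁻¹) ^ (K - n))⁻¹ := mul_le_mul_of_nonneg_right (hcol c) (inv_pos.2 (hlam c)).le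
        _ = K₀ * ((((ℓ + 1 : ℕ) : ℝ)) ^ (K - n)) ^ 3 * ((((ℓ + 1 : ℕ) : ℝ)) ^ (c.1.1 : ℕ) * ((((ℓ + 1 : ℕ) : ℝ))⁻¹) ^ (K - n))⁻¹ := by rw [hinv]
    have h := l1Column_kernelExt (ι := BondIdx D) (κ := PBond (PV 2 ℓ m K hd3 hL) 0) Hσ (fun b => (w 3 b)⁻¹) hw3i
      (fun b c => ks b.src c * ((((ℓ + 1 : ℕ) : ℝ)) ^ (c.1.1 : ℕ) * ((((ℓ + 1 : ℕ) : ℝ))⁻¹) ^ (K - n))⁻¹) hKσ (fun c => K₀ * ((((ℓ + 1 : ℕ) : ℝ)) ^ (K - n)) ^ 3 * ((((ℓ + 1 : ℕ) : ℝ)) ^ (c.1.1 : ℕ) * ((((ℓ + 1 : ℕ) : ℝ))⁻¹) ^ (K - n))⁻¹) hcolσ HS hHSσ X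
    calc ∑ b, (w 3 b)⁻¹ * ‖HS X b‖ ≤ ∑ c : BondIdx D, K₀ * ((((ℓ + 1 : ℕ) : ℝ)) ^ (K - n)) ^ 3 * ((((ℓ + 1 : ℕ) : ℝ)) ^ (c.1.1 : ℕ) * ((((ℓ + 1 : ℕ) : ℝ))⁻¹) ^ (K - n))⁻¹ * ‖X c‖ := h
      _ ≤ ∑ c, K₀ * u c * ‖X c‖ := Finset.sum_le_sum fun c _ =>
          mul_le_mul_of_nonneg_right (by rw [mul_assoc]; exact mul_le_mul_of_nonneg_left (hu c) hK₀) (norm_nonneg _)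
      _ = K₀ * ∑ c, u c * ‖X c‖ := by rw [Finset.mul_sum]; exact Finset.sum_congr rfl fun c _ => by ring
  · -- (X2-CH)ᴹ: the port's pairing letter at scaled data, the factor `λ⁻¹` riding on the weight
    have hscσ : ∀ (Zr : PBond (PV 2 ℓ m K hd3 hL) 0 → ℝ) (s' : ℝ), 0 ≤ s' →
        (∀ (b : PBond (PV 2 ℓ m K hd3 hL) 0) (ν : Fin (2 + 1)),
          w 2 b * ((ℓ + 1 : ℕ) : ℝ) ^ (K - n) * |Zr ⟨b.src.shift ν, b.dir⟩ - Zr b| ≤ s') →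
        ∀ Y : BondIdx D → ℝ,
          |∑ b : PBond (PV 2 ℓ m K hd3 hL) 0, (dcsE ((((ℓ + 1 : ℕ) : ℝ)) ^ (K - n)) (dcE ((((ℓ + 1 : ℕ) : ℝ)) ^ (K - n))
            (WithLp.toLp 2 (Hσ Y)))) b * Zr b| ≤ CP * s' * ∑ c, u c * |Y c| := by
      intro Zr s' hs' hZr Y
      rw [hσ1 Y]
      have h := hpair m hm n K hk1 hk' hMha hMh₄ hR₄ hsize D hDk hAdm w hw Zr s' hs' hZr (fun c => ((((ℓ + 1 : ℕ) : ℝ)) ^ (c.1.1 : ℕ) * ((((ℓ + 1 : ℕ) : ℝ))⁻¹) ^ (K - n))⁻¹ * Y c)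
      calc _ ≤ CP * ((((ℓ + 1 : ℕ) : ℝ)) ^ (K - n)) ^ 3 * s' * ∑ c : BondIdx D, |((((ℓ + 1 : ℕ) : ℝ)) ^ (c.1.1 : ℕ) * ((((ℓ + 1 : ℕ) : ℝ))⁻¹) ^ (K - n))⁻¹ * Y c| := h
        _ = CP * s' * ∑ c : BondIdx D, ((((ℓ + 1 : ℕ) : ℝ)) ^ (K - n)) ^ 3 * ((((ℓ + 1 : ℕ) : ℝ)) ^ (c.1.1 : ℕ) * ((((ℓ + 1 : ℕ) : ℝ))⁻¹) ^ (K - n))⁻¹ * |Y c| := by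
            rw [Finset.mul_sum, Finset.mul_sum]
            exact Finset.sum_congr rfl fun c _ => by rw [abs_mul, abs_of_pos (inv_pos.2 (hlam c))]; ring
        _ ≤ CP * s' * ∑ c, u c * |Y c| :=
            mul_le_mul_of_nonneg_left (Finset.sum_le_sum fun c _ => mul_le_mul_of_nonneg_right (hu c) (abs_nonneg _))
              (mul_nonneg hCP hs')
    exact matrix_curlCurlPairing (F := (⟨ℓ + 1, hL, m, hm⟩ : T3Family)) (n := n) (K := K) (D := D) (w := w) (H := Hσ)
      hCP hu0 hw2 hscσ HS hHSσ Z s hs hZ X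

/-! ## §3 The ♭ knit of record at `H := Hs`: FILE C at the aligned cube sequence -/

/-- ★★ **THE DRESSING LETTER `C_E` AT THE `H` OF RECORD `Hs`, ALIGNED CUBE SEQUENCE (144), P3b's `W₀` BY NAME** — FILE C's
`exists_hWq_dressed_cubeSeq_T3_of_columnLetters` with `hH`∕`hHcol`∕`hCH` DISCHARGED (§2 at `cubeSeqMT3 F n K x₀ ρ S (L·M_h)`, admissible by ✓ `adm22_cubeSeqMT3` under
`R·(L·M_h) ≤ S`) and `hX1` reduced to the displayed level-weighted row (X1♯): for odd `L = ℓ + 1 ≥ 5` there are `M_h⁰, R₀` and `B_H, K₀, C_P ≥ 0` (from `L` alone) such that for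
every member, heights `1 ≤ K − n`, `K − n + 1 ≤ m + K`, `M_h = L^{a′} ≥ M_h⁰`, `R ≥ R₀`, `a′ + 3 ≤ m + n`, centre `x₀`, radii `ρ`, `S ≥ R·(L·M_h)`, level weights `w`, EVERY
ℂ-linear `H` with the display of record `hHS` (= ✓ `exists_flatH_scaledExt` (i)), every index weight `u ≥ η⁻³λ⁻¹`, every `B_Δ ≥ 0` with (X1♯), and every chart datum `(C, D)`
with (55) `hD`, the regularity rows `h49`∕`hDd`∕`hCd` below `R_c`, the (X2-C′) column letter `hCcol`, and the numerics `C₃R_cK₀ ≤ ½`, `a₃ ≤ R_c⁰ < R_c`,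
`(1 + 4B_HC₂R_c⁰)a₃ ≤ 1/(2L)`: there is `W₀` (P3b's) such that for the EXPLICIT dressing term `E` of this `W₀` (`hE` verbatim)
`w₃(b)·‖(W₀(Y − H(D Y)) + E Y)(b)‖ ≤ C₄·r²` for all `Y` of size `r < a₃`, `C₄ = C₀θ² + 2B_ΔC₂ + ½(8C₃(2C_P))θ + 16K₀C₃R_c⁰C₀θ²`, `C₀ = 12L³(1428 + L)`, `θ = 1 + 4B_HC₂R_c⁰`.
[cite: Balaban1985Variational, (44)-(46) p.285, (49) p.285, (55) p.286, (73) p.289, (80)-(89) pp.290-291, (88) p.291, Prop. 4 (97)-(98) pp.292-293, (144) p.300, (157)-(158) p.302, (161)-(163) p.303] -/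
theorem exists_hWq_dressed_cubeSeq_T3_flatHs (ℓ : ℕ) (hL : Odd (ℓ + 1) ∧ 1 < ℓ + 1) (hℓ : 4 ≤ ℓ) :
    ∃ (Mh₀ R₀ : ℕ) (BH K₀ CP : ℝ), 0 ≤ BH ∧ 0 ≤ K₀ ∧ 0 ≤ CP ∧
    ∀ (m : ℕ) (hm : 1 ≤ m) (n K : ℕ) (_ : 1 ≤ K - n) (_ : K - n + 1 ≤ m + K) {Mh R a' : ℕ} (_ : Mh = (ℓ + 1) ^ a') (_ : Mh₀ ≤ Mh) (_ : R₀ ≤ R)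
      (_ : a' + 3 ≤ m + n) (x₀ : Site (PV 2 ℓ m K hd3 hL) 0) (ρ S : ℕ) (hM : 1 ≤ (ℓ + 1) * Mh) (_ : R * ((ℓ + 1) * Mh) ≤ S)
      (w : ℕ → PBond (PV 2 ℓ m K hd3 hL) 0 → ℝ)
      (_ : IsLevWeight (⟨ℓ + 1, hL, m, hm⟩ : T3Family) n K (cubeSeqMT3 (⟨ℓ + 1, hL, m, hm⟩ : T3Family) n K x₀ ρ S ((ℓ + 1) * Mh) hM) w)
      (H : (BondIdx (cubeSeqMT3 (⟨ℓ + 1, hL, m, hm⟩ : T3Family) n K x₀ ρ S ((ℓ + 1) * Mh) hM) → Matrix (Fin 2) (Fin 2) ℂ) →ₗ[ℂ]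
        (PBond (PV 2 ℓ m K hd3 hL) 0 → Matrix (Fin 2) (Fin 2) ℂ))
      (_ : ∀ (X : BondIdx (cubeSeqMT3 (⟨ℓ + 1, hL, m, hm⟩ : T3Family) n K x₀ ρ S ((ℓ + 1) * Mh) hM) → Matrix (Fin 2) (Fin 2) ℂ)
        (b : PBond (PV 2 ℓ m K hd3 hL) 0),
        H X b = ∑ c : BondIdx (cubeSeqMT3 (⟨ℓ + 1, hL, m, hm⟩ : T3Family) n K x₀ ρ S ((ℓ + 1) * Mh) hM),
          (flatH (⟨ℓ + 1, hL, m, hm⟩ : T3Family) n K (cubeSeqMT3 (⟨ℓ + 1, hL, m, hm⟩ : T3Family) n K x₀ ρ S ((ℓ + 1) * Mh) hM) (Pi.single c 1) b *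
            ((((ℓ + 1 : ℕ) : ℝ)) ^ (c.1.1 : ℕ) * ((((ℓ + 1 : ℕ) : ℝ))⁻¹) ^ (K - n))⁻¹) • X c)
      (u : BondIdx (cubeSeqMT3 (⟨ℓ + 1, hL, m, hm⟩ : T3Family) n K x₀ ρ S ((ℓ + 1) * Mh) hM) → ℝ)
      (_ : ∀ c, ((((ℓ + 1 : ℕ) : ℝ)) ^ (K - n)) ^ 3 * ((((ℓ + 1 : ℕ) : ℝ)) ^ (c.1.1 : ℕ) * ((((ℓ + 1 : ℕ) : ℝ))⁻¹) ^ (K - n))⁻¹ ≤ u c)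
      {BΔ : ℝ} (_ : 0 ≤ BΔ)
      (_ : ∀ (Y : BondIdx (cubeSeqMT3 (⟨ℓ + 1, hL, m, hm⟩ : T3Family) n K x₀ ρ S ((ℓ + 1) * Mh) hM) → ℝ) (t : ℝ), 0 ≤ t →
        (∀ c, (((ℓ + 1 : ℕ) : ℝ)) ^ (c.1.1 : ℕ) * ((((ℓ + 1 : ℕ) : ℝ))⁻¹) ^ (K - n) * |Y c| ≤ t) →
        ∀ b : PBond (PV 2 ℓ m K hd3 hL) 0,
          w 3 b * |(dcsE ((((ℓ + 1 : ℕ) : ℝ)) ^ (K - n)) (dcE ((((ℓ + 1 : ℕ) : ℝ)) ^ (K - n))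
            (WithLp.toLp 2 (flatH (⟨ℓ + 1, hL, m, hm⟩ : T3Family) n K (cubeSeqMT3 (⟨ℓ + 1, hL, m, hm⟩ : T3Family) n K x₀ ρ S ((ℓ + 1) * Mh) hM) Y)))) b| ≤
            BΔ * t)
      (C D : (PBond (PV 2 ℓ m K hd3 hL) 0 → Matrix (Fin 2) (Fin 2) ℂ) →
        (BondIdx (cubeSeqMT3 (⟨ℓ + 1, hL, m, hm⟩ : T3Family) n K x₀ ρ S ((ℓ + 1) * Mh) hM) → Matrix (Fin 2) (Fin 2) ℂ))
      {C₂ Rc Rc₀ a₃ C₃ : ℝ}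
      (_ : ∀ (Y : PBond (PV 2 ℓ m K hd3 hL) 0 → Matrix (Fin 2) (Fin 2) ℂ) (r' : ℝ), r' < Rc → (∀ b, w 1 b * ‖Y b‖ ≤ r') →
        (∀ (b : PBond (PV 2 ℓ m K hd3 hL) 0) (ν : Fin 3), w 2 b * ((ℓ + 1 : ℕ) : ℝ) ^ (K - n) * ‖Y ⟨b.src.shift ν, b.dir⟩ - Y b‖ ≤ r') →
        ∀ c', ‖D Y c'‖ ≤ 4 * C₂ * r' ^ 2)
      (_ : ∀ (Y : PBond (PV 2 ℓ m K hd3 hL) 0 → Matrix (Fin 2) (Fin 2) ℂ) (r : ℝ), r < Rc → (∀ b, w 1 b * ‖Y b‖ ≤ r) →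
        (∀ (b : PBond (PV 2 ℓ m K hd3 hL) 0) (ν : Fin 3), w 2 b * ((ℓ + 1 : ℕ) : ℝ) ^ (K - n) * ‖Y ⟨b.src.shift ν, b.dir⟩ - Y b‖ ≤ r) →
        ∀ᶠ X in 𝓝 Y, D X = C (X - H (D X)))
      (_ : ∀ (Y : PBond (PV 2 ℓ m K hd3 hL) 0 → Matrix (Fin 2) (Fin 2) ℂ) (r : ℝ), r < Rc → (∀ b, w 1 b * ‖Y b‖ ≤ r) →
        (∀ (b : PBond (PV 2 ℓ m K hd3 hL) 0) (ν : Fin 3), w 2 b * ((ℓ + 1 : ℕ) : ℝ) ^ (K - n) * ‖Y ⟨b.src.shift ν, b.dir⟩ - Y b‖ ≤ r) →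
        DifferentiableAt ℂ D Y)
      (_ : ∀ (Y : PBond (PV 2 ℓ m K hd3 hL) 0 → Matrix (Fin 2) (Fin 2) ℂ) (r : ℝ), r < Rc → (∀ b, w 1 b * ‖Y b‖ ≤ r) →
        (∀ (b : PBond (PV 2 ℓ m K hd3 hL) 0) (ν : Fin 3), w 2 b * ((ℓ + 1 : ℕ) : ℝ) ^ (K - n) * ‖Y ⟨b.src.shift ν, b.dir⟩ - Y b‖ ≤ r) →
        DifferentiableAt ℂ C (Y - H (D Y)))
      (_ : ∀ (Y : PBond (PV 2 ℓ m K hd3 hL) 0 → Matrix (Fin 2) (Fin 2) ℂ) (r : ℝ), r < Rc → (∀ b, w 1 b * ‖Y b‖ ≤ r) →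
        (∀ (b : PBond (PV 2 ℓ m K hd3 hL) 0) (ν : Fin 3), w 2 b * ((ℓ + 1 : ℕ) : ℝ) ^ (K - n) * ‖Y ⟨b.src.shift ν, b.dir⟩ - Y b‖ ≤ r) →
        ∀ δ : PBond (PV 2 ℓ m K hd3 hL) 0 → Matrix (Fin 2) (Fin 2) ℂ,
          ∑ c', u c' * ‖fderiv ℂ C (Y - H (D Y)) δ c'‖ ≤ C₃ * r * ∑ b, (w 3 b)⁻¹ * ‖δ b‖)
      (_ : C₃ * Rc * K₀ ≤ 1 / 2) (_ : 0 ≤ C₃) (_ : 0 ≤ C₂) (_ : 0 ≤ Rc₀) (_ : Rc₀ < Rc) (_ : a₃ ≤ Rc₀)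
      (_ : (1 + 4 * BH * C₂ * Rc₀) * a₃ ≤ 1 / (2 * ((ℓ + 1 : ℕ) : ℝ))),
    ∃ W₀ : (PBond (PV 2 ℓ m K hd3 hL) 0 → Matrix (Fin 2) (Fin 2) ℂ) → (PBond (PV 2 ℓ m K hd3 hL) 0 → Matrix (Fin 2) (Fin 2) ℂ),
      (∀ A δ : PBond (PV 2 ℓ m K hd3 hL) 0 → Matrix (Fin 2) (Fin 2) ℂ, fderiv ℂ (fun A : PBond (PV 2 ℓ m K hd3 hL) 0 → Matrix (Fin 2) (Fin 2) ℂ => (∑ p : Plaq (PV 2 ℓ m K hd3 hL) 0, (1 - (2 : ℂ)⁻¹ * Matrix.trace (exp ((Complex.I * ((((((ℓ + 1 : ℕ) : ℝ)⁻¹) ^ (K - n) : ℝ)) : ℂ)) • A ⟨p.src, p.μ⟩) * exp ((Complex.I * ((((((ℓ + 1 : ℕ) : ℝ)⁻¹) ^ (K - n) : ℝ)) : ℂ)) • A ⟨p.src.shift p.μ, p.ν⟩) * exp (-((Complex.I * ((((((ℓ + 1 : ℕ) : ℝ)⁻¹) ^ (K - n) : ℝ)) : ℂ)) • A ⟨p.src.shift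 p.ν, p.μ⟩)) * exp (-((Complex.I * ((((((ℓ + 1 : ℕ) : ℝ)⁻¹) ^ (K - n) : ℝ)) : ℂ)) • A ⟨p.src, p.ν⟩))) + (2 : ℂ)⁻¹ * Matrix.trace (((Complex.I * ((((((ℓ + 1 : ℕ) : ℝ)⁻¹) ^ (K - n) : ℝ)) : ℂ)) • A ⟨p.src, p.μ⟩) + ((Complex.I * ((((((ℓ + 1 : ℕ) : ℝ)⁻¹) ^ (K - n) : ℝ)) : ℂ)) • A ⟨p.src.shift p.μ, p.ν⟩) + (-((Complex.I * ((((((ℓ + 1 : ℕ) : ℝ)⁻¹) ^ (K - n) : ℝ)) : ℂ)) • A ⟨p.src.shift p.ν, p.μ⟩)) + (-((Complex.I * ((((((ℓ + 1 : ℕ) : ℝ)⁻¹) ^ (K - n) : ℝ)) : ℂ)) • A ⟨p.src, p.ν⟩))) + (4 : ℂ)⁻¹ * Matrix.trace ((((Complex.I * ((((((ℓ + 1 : ℕ) : ℝ)⁻¹) ^ (K - n) : ℝ)) : ℂ)) • A ⟨p.src, p.μ⟩) + ((Complex.I * ((((((ℓ + 1 : ℕ) : ℝ)⁻¹) ^ (K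 - n) : ℝ)) : ℂ)) • A ⟨p.src.shift p.μ, p.ν⟩) + (-((Complex.I * ((((((ℓ + 1 : ℕ) : ℝ)⁻¹) ^ (K - n) : ℝ)) : ℂ)) • A ⟨p.src.shift p.ν, p.μ⟩)) + (-((Complex.I * ((((((ℓ + 1 : ℕ) : ℝ)⁻¹) ^ (K - n) : ℝ)) : ℂ)) • A ⟨p.src, p.ν⟩))) ^ 2)))) A δ =
        (((((ℓ + 1 : ℕ) : ℝ)⁻¹) ^ (K - n) : ℝ) : ℂ) ^ 4 * ∑ b : PBond (PV 2 ℓ m K hd3 hL) 0, Matrix.trace (W₀ A b * δ b)) ∧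
      Differentiable ℂ W₀ ∧
      ∀ E : (PBond (PV 2 ℓ m K hd3 hL) 0 → Matrix (Fin 2) (Fin 2) ℂ) → (PBond (PV 2 ℓ m K hd3 hL) 0 → Matrix (Fin 2) (Fin 2) ℂ),
        (∀ (Y : PBond (PV 2 ℓ m K hd3 hL) 0 → Matrix (Fin 2) (Fin 2) ℂ) (b : PBond (PV 2 ℓ m K hd3 hL) 0) (i j : Fin 2), E Y b i j = (((((((ℓ + 1 : ℕ) : ℝ)⁻¹) ^ (K - n)) : ℝ) : ℂ) ^ 4)⁻¹ *
          (-((((((((ℓ + 1 : ℕ) : ℝ)⁻¹) ^ (K - n)) : ℝ) : ℂ) ^ 2 / 2) * ∑ p : Plaq (PV 2 ℓ m K hd3 hL) 0, Matrix.trace ((H (D Y) ⟨p.src, p.μ⟩ + H (D Y) ⟨p.src.shift p.μ, p.ν⟩ - H (D Y) ⟨p.src.shift p.ν, p.μ⟩ - H (D Y) ⟨p.src, p.ν⟩) *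
              (((Pi.single b (Matrix.single j i (1 : ℂ)) : PBond (PV 2 ℓ m K hd3 hL) 0 → Matrix (Fin 2) (Fin 2) ℂ)) ⟨p.src, p.μ⟩ + ((Pi.single b (Matrix.single j i (1 : ℂ)) : PBond (PV 2 ℓ m K hd3 hL) 0 → Matrix (Fin 2) (Fin 2) ℂ)) ⟨p.src.shift p.μ, p.ν⟩ -
                ((Pi.single b (Matrix.single j i (1 : ℂ)) : PBond (PV 2 ℓ m K hd3 hL) 0 → Matrix (Fin 2) (Fin 2) ℂ)) ⟨p.src.shift p.ν, p.μ⟩ - ((Pi.single b (Matrix.single j i (1 : ℂ)) : PBond (PV 2 ℓ m K hd3 hL) 0 → Matrix (Fin 2) (Fin 2) ℂ)) ⟨p.src, p.ν⟩)))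
            - (((((((ℓ + 1 : ℕ) : ℝ)⁻¹) ^ (K - n)) : ℝ) : ℂ) ^ 2 / 2) * ∑ p : Plaq (PV 2 ℓ m K hd3 hL) 0, Matrix.trace (((Y - H (D Y)) ⟨p.src, p.μ⟩ + (Y - H (D Y)) ⟨p.src.shift p.μ, p.ν⟩ - (Y - H (D Y)) ⟨p.src.shift p.ν, p.μ⟩ - (Y - H (D Y)) ⟨p.src, p.ν⟩) *
              (H (fderiv ℂ D Y (Pi.single b (Matrix.single j i (1 : ℂ)))) ⟨p.src, p.μ⟩ + H (fderiv ℂ D Y (Pi.single b (Matrix.single j i (1 : ℂ)))) ⟨p.src.shift p.μ, p.ν⟩ -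
                H (fderiv ℂ D Y (Pi.single b (Matrix.single j i (1 : ℂ)))) ⟨p.src.shift p.ν, p.μ⟩ - H (fderiv ℂ D Y (Pi.single b (Matrix.single j i (1 : ℂ)))) ⟨p.src, p.ν⟩))
            - ((((((ℓ + 1 : ℕ) : ℝ)⁻¹) ^ (K - n)) : ℝ) : ℂ) ^ 4 * ∑ b' : PBond (PV 2 ℓ m K hd3 hL) 0, Matrix.trace (W₀ (Y - H (D Y)) b' * H (fderiv ℂ D Y (Pi.single b (Matrix.single j i (1 : ℂ)))) b'))) →
        ∀ (Y : PBond (PV 2 ℓ m K hd3 hL) 0 → Matrix (Fin 2) (Fin 2) ℂ) (r : ℝ), r < a₃ → (∀ b, w 1 b * ‖Y b‖ ≤ r) →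
          (∀ (b : PBond (PV 2 ℓ m K hd3 hL) 0) (ν : Fin 3), w 2 b * ((ℓ + 1 : ℕ) : ℝ) ^ (K - n) * ‖Y ⟨b.src.shift ν, b.dir⟩ - Y b‖ ≤ r) →
          ∀ b, w 3 b * ‖(W₀ (Y - H (D Y)) + E Y) b‖ ≤
            (12 * (((ℓ + 1 : ℕ) : ℝ) ^ 3 * (1428 + ((ℓ + 1 : ℕ) : ℝ))) * (1 + 4 * BH * C₂ * Rc₀) ^ 2 +
              (2 * BΔ * C₂ + 2⁻¹ * (8 * C₃ * (2 * CP)) * (1 + 4 * BH * C₂ * Rc₀) +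
                (16 * K₀ * C₃) * Rc₀ * (12 * (((ℓ + 1 : ℕ) : ℝ) ^ 3 * (1428 + ((ℓ + 1 : ℕ) : ℝ)))) * (1 + 4 * BH * C₂ * Rc₀) ^ 2)) * r ^ 2 := by
  obtain ⟨Mh₀, R₀, BH, K₀, CP, hBH, hK₀, hCP, hmain⟩ := hLetters_flatHs_of_adm22 ℓ hL hℓ
  refine ⟨max Mh₀ 2, max R₀ 1, BH, K₀, CP, hBH, hK₀, hCP, ?_⟩
  intro m hm n K hk1 hk' Mh R a' hMha hMh hR hsize x₀ ρ S hM hRS w hw H hHS u hu BΔ hBΔ hX1s C D C₂ Rc Rc₀ a₃ C₃ hD h49 hDd hCd hCcol hsmall hC₃ hC₂ hR₀0 hR₀ ha₃ hθ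
  -- the datum is admissible; the H-side letters at it
  have hAdm : Adm22 (cubeSeqMT3 (⟨ℓ + 1, hL, m, hm⟩ : T3Family) n K x₀ ρ S ((ℓ + 1) * Mh) hM) R ((ℓ + 1) * Mh) :=
    adm22_cubeSeqMT3 (⟨ℓ + 1, hL, m, hm⟩ : T3Family) n K x₀ ρ hM hRS
  have hDk : (cubeSeqMT3 (⟨ℓ + 1, hL, m, hm⟩ : T3Family) n K x₀ ρ S ((ℓ + 1) * Mh) hM).k = K - n :=
    cubeSeqMT3_k (⟨ℓ + 1, hL, m, hm⟩ : T3Family) n K x₀ ρ S ((ℓ + 1) * Mh) hM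
  obtain ⟨hH, hX1, hHcol, hCH⟩ := hmain m hm n K hk1 hk' hMha (le_trans (le_max_left _ _) hMh) (le_trans (le_max_left _ _) hR) hsize
    (cubeSeqMT3 (⟨ℓ + 1, hL, m, hm⟩ : T3Family) n K x₀ ρ S ((ℓ + 1) * Mh) hM) hDk hAdm w hw H hHS u hu
  -- the separation gives FILE C's `2L ≤ S`
  have hS : 2 * ((⟨ℓ + 1, hL, m, hm⟩ : T3Family)).L ≤ S := by
    show 2 * (ℓ + 1) ≤ S
    have hR1 : 1 ≤ R := le_trans (le_max_right _ _) hR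
    have hM2 : 2 ≤ Mh := le_trans (le_max_right _ _) hMh
    calc 2 * (ℓ + 1) = 1 * ((ℓ + 1) * 2) := by ring
      _ ≤ R * ((ℓ + 1) * Mh) := Nat.mul_le_mul hR1 (Nat.mul_le_mul_left _ hM2)
      _ ≤ S := hRS
  have hη3 : 0 ≤ ((((ℓ + 1 : ℕ) : ℝ)) ^ (K - n)) ^ 3 := by positivity
  have hu0 : ∀ c, 0 ≤ u c := fun c => (mul_nonneg hη3 (inv_nonneg.2 (by positivity))).trans (hu c)
  have hCP2 : 0 ≤ 2 * CP := by positivity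
  exact exists_hWq_dressed_cubeSeq_T3_of_columnLetters (⟨ℓ + 1, hL, m, hm⟩ : T3Family) n K x₀ ρ S ((ℓ + 1) * Mh) hM hS hw
    u hu0 H C D hH hD (hX1 hBΔ hX1s) h49 hDd hCd hCcol hHcol hCH hsmall hC₃ hK₀ hCP2 hC₂ hBH hR₀0 hR₀ ha₃ hθ

end Summit.QuantumFields.YangMills.Theorems.HalvingDressingLetter

end
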